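import Literature.NumberTheory.Automorphic.UnitaryRankThreeUnipotent
import HarnessLib

/-!
# Rank-3 isotropic unitary groups, II: the torus

Topic `NumberTheory/Automorphic`; namespace `Literature.NumberTheory.Automorphic.UnitaryRankThree`.  KERNEL only
(theorems, no definition, no notation, no named fact, no `sorry`).  Continuation of `UnitaryRankThreeUnipotent`
(same setting: `K` a field with `2 ≠ 0`, `σ` an involution of `K`, `σ θ₀ = −θ₀ ≠ 0`, `σ c = c ≠ 0`, the standard
isotropic Gram matrix `J₀ = !![0, 0, θ₀; 0, c, 0; -θ₀, 0, 0]`, `U = unitaryGroupOfForm σ J₀ ≤ GL₃(K)`).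

For ANY homomorphism `χ : U →* A` to a commutative group, `χ` kills the torus elements of determinant one
`diag(a, σ(a)/a, σ(a)⁻¹)` (`apply_eq_one_of_val_eq_diagSU`).  Ingredients: the long-root `SL₂`-relation
`diag(ρ, 1, ρ⁻¹) = E(ρ) F(−ρ⁻¹) E(ρ) E(−1) F(1) E(−1)` for `σ ρ = ρ` (`apply_eq_one_of_val_eq_diagFixed`); the
involutive isometry `r` swapping `v` with the vector `x = e + (c/2θ₀) f ∈ H = ⟨e, f⟩` of the same length, which
conjugates the `U(1)` of the line `K v` (`diag(1, u, 1)`) into `U(H)`, where the Bruhat factorisation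
`F(γ) · diag(a, 1, σ(a)⁻¹) · E(δ)` (`a = (u+1)/2`) applies (`apply_diag_eq_apply_diagMid`); and the splitting
`a = a_u · ρ` with `σ ρ = ρ` (`apply_diag_eq_apply_diagMid'`, the trace-zero case through `a = (1+θ₀) · a/(1+θ₀)`).
Part III (`UnitaryRankThreeIsotropicCharacters`) adds the parabolic step and the big cell and concludes
`SU(J₀) ≤ ker χ` [Dieudonne1971GroupesClassiques, Chap. II §5].

## References

* J. Dieudonné, *La géométrie des groupes classiques*, 3e éd., Springer (1971), Chap. II §§4–5
  [Dieudonne1971GroupesClassiques].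
-/

set_option autoImplicit false

open Matrix

namespace Literature.NumberTheory.Automorphic

namespace UnitaryRankThree

variable {K : Type*} [Field K] {σ : K →+* K} {θ₀ c : K} {A : Type*} [CommGroup A]

/-! ## §0 Plumbing (as in Part I) -/

/-- An invertible matrix satisfying the unitarity identity gives an element of `U` with that matrix. [folklore] -/
private theorem exists_val_eq (M : Matrix (Fin 3) (Fin 3) K) (hd : M.det ≠ 0)
    (hm : (M.map σ)ᵀ * (!![(0 : K), 0, θ₀; 0, c, 0; -θ₀, 0, 0] : Matrix (Fin 3) (Fin 3) K) * M =
      (!![(0 : K), 0, θ₀; 0, c, 0; -θ₀, 0, 0] : Matrix (Fin 3) (Fin 3) K)) :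
    ∃ g : ↥(unitaryGroupOfForm σ !![(0 : K), 0, θ₀; 0, c, 0; -θ₀, 0, 0]), g.1.1 = M :=
  ⟨⟨Matrix.GeneralLinearGroup.mkOfDetNeZero M hd, hm⟩, rfl⟩

/-- The matrix of a product. [folklore] -/
private theorem val_mul (g h : ↥(unitaryGroupOfForm σ !![(0 : K), 0, θ₀; 0, c, 0; -θ₀, 0, 0])) :
    (g * h).1.1 = g.1.1 * h.1.1 := rfl

/-- The matrix of an inverse, from a left inverse. [folklore] -/
private theorem val_inv_eq {g : ↥(unitaryGroupOfForm σ !![(0 : K), 0, θ₀; 0, c, 0; -θ₀, 0, 0])}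
    {M' : Matrix (Fin 3) (Fin 3) K} (h : M' * g.1.1 = 1) : (g⁻¹).1.1 = M' := by
  have e : (g⁻¹).1.1 = (g.1.1)⁻¹ := by rw [Subgroup.coe_inv, Matrix.coe_units_inv]
  rw [e]
  exact Matrix.inv_eq_left_inv h

/-- The membership identity of an element of `U`. [folklore] -/
private theorem val_mem (g : ↥(unitaryGroupOfForm σ !![(0 : K), 0, θ₀; 0, c, 0; -θ₀, 0, 0])) :
    (g.1.1.map σ)ᵀ * (!![(0 : K), 0, θ₀; 0, c, 0; -θ₀, 0, 0] : Matrix (Fin 3) (Fin 3) K) * g.1.1 =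
      (!![(0 : K), 0, θ₀; 0, c, 0; -θ₀, 0, 0] : Matrix (Fin 3) (Fin 3) K) := g.2

/-- Elements of `U` with the same matrix are equal. [folklore] -/
private theorem ext_val {g h : ↥(unitaryGroupOfForm σ !![(0 : K), 0, θ₀; 0, c, 0; -θ₀, 0, 0])}
    (e : g.1.1 = h.1.1) : g = h := Subtype.ext (Units.ext e)

/-- `χ` is conjugation invariant. [folklore] -/
private theorem chi_conj (χ : ↥(unitaryGroupOfForm σ !![(0 : K), 0, θ₀; 0, c, 0; -θ₀, 0, 0]) →* A)
    (p g : ↥(unitaryGroupOfForm σ !![(0 : K), 0, θ₀; 0, c, 0; -θ₀, 0, 0])) : χ (p * g * p⁻¹) = χ g := by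
  rw [map_mul, map_mul, map_inv, mul_right_comm, mul_inv_cancel, one_mul]

/-- determinant of a diagonal matrix. [folklore] -/
private theorem det_diag (a u d : K) : (!![a, 0, 0; 0, u, 0; 0, 0, d] : Matrix (Fin 3) (Fin 3) K).det = a * u * d := by
  simp [Matrix.det_fin_three]

/-- The long-root elements `F(r) = !![1,0,0;0,1,0;r,0,1]`, `σ r = r`, lie in `U`. [cite: Dieudonne1971GroupesClassiques, Chap. II §4] -/
theorem lowerCentral_mem (r : K) (hr : σ r = r) :
    ((!![(1 : K), 0, 0; 0, 1, 0; r, 0, 1] : Matrix (Fin 3) (Fin 3) K).map σ)ᵀ *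
        (!![(0 : K), 0, θ₀; 0, c, 0; -θ₀, 0, 0] : Matrix (Fin 3) (Fin 3) K) * !![(1 : K), 0, 0; 0, 1, 0; r, 0, 1] =
      !![(0 : K), 0, θ₀; 0, c, 0; -θ₀, 0, 0] := by
  ext i j
  fin_cases i <;> fin_cases j <;> simp [Matrix.mul_apply, Fin.sum_univ_three, hr]
  ring

/-! ## §1 The torus: `χ` kills `diag(a, σ(a)/a, σ(a)⁻¹)` -/

section Chi

variable (hσ : ∀ x, σ (σ x) = x) (hθ : σ θ₀ = -θ₀) (hθ0 : θ₀ ≠ 0) (hc : σ c = c) (hc0 : c ≠ 0) (h2 : (2 : K) ≠ 0)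

include hσ hθ hθ0 hc h2 in
/-- `χ (diag(ρ, 1, ρ⁻¹)) = 1` for `σ ρ = ρ`: the `SL₂`-relation `diag(ρ,1,ρ⁻¹) = E(ρ) F(−ρ⁻¹) E(ρ) E(−1) F(1) E(−1)`
in the long-root `SL₂(K₀) ≤ U`. [cite: Dieudonne1971GroupesClassiques, Chap. II §5] -/
theorem apply_eq_one_of_val_eq_diagFixed (χ : ↥(unitaryGroupOfForm σ !![(0 : K), 0, θ₀; 0, c, 0; -θ₀, 0, 0]) →* A)
    (g : ↥(unitaryGroupOfForm σ !![(0 : K), 0, θ₀; 0, c, 0; -θ₀, 0, 0])) (ρ : K) (hρ : σ ρ = ρ) (hρ0 : ρ ≠ 0)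
    (hg : g.1.1 = !![ρ, 0, 0; 0, 1, 0; 0, 0, ρ⁻¹]) : χ g = 1 := by
  -- the six long-root elements
  have hE : ∀ x : K, σ x = x → ∃ e : ↥(unitaryGroupOfForm σ !![(0 : K), 0, θ₀; 0, c, 0; -θ₀, 0, 0]),
      e.1.1 = !![(1 : K), 0, x; 0, 1, 0; 0, 0, 1] ∧ χ e = 1 := by
    intro x hx
    obtain ⟨e, he⟩ := exists_val_eq (σ := σ) (θ₀ := θ₀) (c := c) !![(1 : K), 0, x; 0, 1, 0; 0, 0, 1]
      (by simp [Matrix.det_fin_three]) (upperCentral_mem x hx)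
    exact ⟨e, he, apply_eq_one_of_val_eq_upperCentral hσ hθ hθ0 h2 χ e x hx he⟩
  have hF : ∀ x : K, σ x = x → ∃ f : ↥(unitaryGroupOfForm σ !![(0 : K), 0, θ₀; 0, c, 0; -θ₀, 0, 0]),
      f.1.1 = !![(1 : K), 0, 0; 0, 1, 0; x, 0, 1] ∧ χ f = 1 := by
    intro x hx
    obtain ⟨f, hf⟩ := exists_val_eq (σ := σ) (θ₀ := θ₀) (c := c) !![(1 : K), 0, 0; 0, 1, 0; x, 0, 1]
      (by simp [Matrix.det_fin_three]) (lowerCentral_mem x hx)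
    exact ⟨f, hf, apply_eq_one_of_val_eq_lower hσ hθ hθ0 hc h2 χ f 0 0 x hf⟩
  obtain ⟨e₁, he₁, hce₁⟩ := hE ρ hρ
  obtain ⟨f₁, hf₁, hcf₁⟩ := hF (-ρ⁻¹) (by rw [map_neg, map_inv₀, hρ])
  obtain ⟨e₂, he₂, hce₂⟩ := hE (-1) (by rw [map_neg, map_one])
  obtain ⟨f₂, hf₂, hcf₂⟩ := hF 1 (map_one σ)
  have key : (e₁ * f₁ * e₁ * e₂ * f₂ * e₂).1.1 = g.1.1 := by
    rw [val_mul, val_mul, val_mul, val_mul, val_mul, he₁, hf₁, he₂, hf₂, hg]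
    ext i j
    fin_cases i <;> fin_cases j <;> simp [Matrix.mul_apply, Fin.sum_univ_three, hρ0]
  rw [← ext_val key, map_mul, map_mul, map_mul, map_mul, map_mul, hce₁, hcf₁, hce₂, hcf₂]
  simp

include hσ hθ hθ0 hc hc0 h2 in
/-- **The swap isometry and the big cell in `U(H)`**: for `u σ(u) = 1` with `u + 1 ≠ 0`, writing `a = (u+1)/2`,
`χ (diag(a, 1, σ(a)⁻¹)) = χ (diag(1, u, 1))` — the involution `r` exchanging `v` with `x = e + (c/2θ₀) f`
(`h(x,x) = h(v,v) = c`) conjugates `diag(1,u,1)` to an element of `U(H)` whose Bruhat factorisation is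
`F(γ) · diag(a, 1, σ(a)⁻¹) · E(δ)` with `σ`-fixed `γ, δ`. [cite: Dieudonne1971GroupesClassiques, Chap. II §5] -/
theorem apply_diag_eq_apply_diagMid (χ : ↥(unitaryGroupOfForm σ !![(0 : K), 0, θ₀; 0, c, 0; -θ₀, 0, 0]) →* A)
    (u : K) (hu : u * σ u = 1) (hu1 : u + 1 ≠ 0)
    (m z : ↥(unitaryGroupOfForm σ !![(0 : K), 0, θ₀; 0, c, 0; -θ₀, 0, 0]))
    (hm : m.1.1 = !![(u + 1) / 2, 0, 0; 0, 1, 0; 0, 0, (σ ((u + 1) / 2))⁻¹])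
    (hz : z.1.1 = !![(1 : K), 0, 0; 0, u, 0; 0, 0, 1]) : χ m = χ z := by
  have hu0 : u ≠ 0 := fun h => by rw [h, zero_mul] at hu; exact zero_ne_one hu
  have hσu : σ u = u⁻¹ := (inv_eq_of_mul_eq_one_right hu).symm
  have hu1' : 1 + u ≠ 0 := by rwa [add_comm]
  have hσ2 : σ (2 : K) = 2 := map_ofNat σ 2
  have hσθinv : σ θ₀⁻¹ = -θ₀⁻¹ := by rw [map_inv₀, hθ, neg_inv]
  -- `λ = c / (2 θ₀)` and the swap isometry `r`
  set l : K := c / (2 * θ₀) with hl_def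
  have hl0 : l ≠ 0 := div_ne_zero hc0 (mul_ne_zero h2 hθ0)
  have hσl : σ l = -l := by rw [hl_def, map_div₀, hc, map_mul, hσ2, hθ]; field_simp
  have hRmem : ((!![(1 : K) / 2, 1, -1 / (2 * l); 1 / 2, 0, 1 / (2 * l); -l / 2, l, 1 / 2] : Matrix (Fin 3) (Fin 3) K).map σ)ᵀ *
        (!![(0 : K), 0, θ₀; 0, c, 0; -θ₀, 0, 0] : Matrix (Fin 3) (Fin 3) K) *
        !![(1 : K) / 2, 1, -1 / (2 * l); 1 / 2, 0, 1 / (2 * l); -l / 2, l, 1 / 2] =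
      !![(0 : K), 0, θ₀; 0, c, 0; -θ₀, 0, 0] := by
    have hc' : c = 2 * θ₀ * l := by rw [hl_def]; field_simp
    ext i j
    fin_cases i <;> fin_cases j <;>
      simp [Matrix.mul_apply, Fin.sum_univ_three, hσ2, hσl, map_div₀, map_one, hc'] <;> field_simp <;> ring
  have hRdet : (!![(1 : K) / 2, 1, -1 / (2 * l); 1 / 2, 0, 1 / (2 * l); -l / 2, l, 1 / 2] :
      Matrix (Fin 3) (Fin 3) K).det ≠ 0 := by
    have : (!![(1 : K) / 2, 1, -1 / (2 * l); 1 / 2, 0, 1 / (2 * l); -l / 2, l, 1 / 2] :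
        Matrix (Fin 3) (Fin 3) K).det = -1 := by
      rw [Matrix.det_fin_three]
      simp
      field_simp
      ring
    rw [this]
    exact neg_ne_zero.2 one_ne_zero
  obtain ⟨r, hr⟩ := exists_val_eq (σ := σ) (θ₀ := θ₀) (c := c) _ hRdet hRmem
  have hri : (r⁻¹).1.1 = !![(1 : K) / 2, 1, -1 / (2 * l); 1 / 2, 0, 1 / (2 * l); -l / 2, l, 1 / 2] := by
    refine val_inv_eq ?_
    rw [hr]
    ext i j
    fin_cases i <;> fin_cases j <;> simp [Matrix.mul_apply, Fin.sum_univ_three, hl0] <;> field_simp <;> ring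
  -- `r z r⁻¹` has matrix `G(u)`, which factors as `F(γ) M(a) E(δ)`
  set a : K := (u + 1) / 2 with ha_def
  have ha0 : a ≠ 0 := div_ne_zero hu1 h2
  have hσa : σ a = (u + 1) / (2 * u) := by
    rw [ha_def, map_div₀, map_add, hσu, map_one, hσ2]; field_simp; ring
  have hσa0 : σ a ≠ 0 := by rw [hσa]; exact div_ne_zero hu1 (mul_ne_zero h2 hu0)
  set γ : K := l * (u - 1) / (u + 1) with hγ_def
  set δ : K := (u - 1) / (l * (u + 1)) with hδ_def
  have hσγ : σ γ = γ := by
    rw [hγ_def, map_div₀, map_mul, hσl, map_sub, map_add, hσu, map_one]; field_simp; ring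
  have hσδ : σ δ = δ := by
    rw [hδ_def, map_div₀, map_mul, hσl, map_sub, map_add, hσu, map_one]; field_simp; ring
  obtain ⟨f₁, hf₁⟩ := exists_val_eq (σ := σ) (θ₀ := θ₀) (c := c) !![(1 : K), 0, 0; 0, 1, 0; γ, 0, 1]
    (by simp [Matrix.det_fin_three]) (lowerCentral_mem γ hσγ)
  obtain ⟨e₁, he₁⟩ := exists_val_eq (σ := σ) (θ₀ := θ₀) (c := c) !![(1 : K), 0, δ; 0, 1, 0; 0, 0, 1]
    (by simp [Matrix.det_fin_three]) (upperCentral_mem δ hσδ)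
  have key : (r * z * r⁻¹).1.1 = (f₁ * m * e₁).1.1 := by
    rw [val_mul, val_mul, val_mul, val_mul, hr, hz, hri, hf₁, hm, he₁, hσa]
    simp only [ha_def, hγ_def, hδ_def]
    ext i j
    fin_cases i <;> fin_cases j <;> simp [Matrix.mul_apply, Fin.sum_univ_three] <;> field_simp <;> ring
  have h1 : χ f₁ = 1 := apply_eq_one_of_val_eq_lower hσ hθ hθ0 hc h2 χ f₁ 0 0 γ hf₁
  have h3 : χ e₁ = 1 := apply_eq_one_of_val_eq_upperCentral hσ hθ hθ0 h2 χ e₁ δ hσδ he₁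
  calc χ m = χ (f₁ * m * e₁) := by rw [map_mul, map_mul, h1, h3, one_mul, mul_one]
    _ = χ (r * z * r⁻¹) := by rw [ext_val key]
    _ = χ z := chi_conj χ r z

/-- `diag(1, u, 1) ∈ U` for `u σ(u) = 1` (the `U(1)` of the anisotropic line `K v`).
[cite: Dieudonne1971GroupesClassiques, Chap. II §4] -/
theorem diagMid_mem (u : K) (hu : u * σ u = 1) :
    ((!![(1 : K), 0, 0; 0, u, 0; 0, 0, 1] : Matrix (Fin 3) (Fin 3) K).map σ)ᵀ *
        (!![(0 : K), 0, θ₀; 0, c, 0; -θ₀, 0, 0] : Matrix (Fin 3) (Fin 3) K) * !![(1 : K), 0, 0; 0, u, 0; 0, 0, 1] =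
      !![(0 : K), 0, θ₀; 0, c, 0; -θ₀, 0, 0] := by
  have hu' : σ u * u = 1 := by rw [mul_comm]; exact hu
  ext i j
  fin_cases i <;> fin_cases j <;> simp [Matrix.mul_apply, Fin.sum_univ_three]
  linear_combination c * hu'

include hσ hθ hθ0 hc hc0 h2 in
/-- For `a ≠ 0` with `a + σ(a) ≠ 0`: `χ (diag(a, 1, σ(a)⁻¹)) = χ (diag(1, a/σ(a), 1))` (take `u = a/σ(a)` above and
split off the `σ`-fixed factor `ρ = a / ((u+1)/2)`). [cite: Dieudonne1971GroupesClassiques, Chap. II §5] -/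
theorem apply_diag_eq_apply_diagMid_of_trace_ne_zero
    (χ : ↥(unitaryGroupOfForm σ !![(0 : K), 0, θ₀; 0, c, 0; -θ₀, 0, 0]) →* A) (a : K) (ha0 : a ≠ 0)
    (htr : a + σ a ≠ 0) (m z : ↥(unitaryGroupOfForm σ !![(0 : K), 0, θ₀; 0, c, 0; -θ₀, 0, 0]))
    (hm : m.1.1 = !![a, 0, 0; 0, 1, 0; 0, 0, (σ a)⁻¹]) (hz : z.1.1 = !![(1 : K), 0, 0; 0, a / σ a, 0; 0, 0, 1]) :
    χ m = χ z := by
  have hσa0 : σ a ≠ 0 := fun h => ha0 (by simpa [hσ] using congrArg σ h)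
  set u : K := a / σ a with hu_def
  have hu : u * σ u = 1 := by rw [hu_def, map_div₀, hσ]; field_simp
  have hu1 : u + 1 ≠ 0 := by
    intro h
    apply htr
    have h' : a / σ a = -1 := by rw [← hu_def]; linear_combination h
    rw [div_eq_iff hσa0] at h'
    linear_combination h'
  set a' : K := (u + 1) / 2 with ha'_def
  have ha'0 : a' ≠ 0 := div_ne_zero hu1 h2
  have hσ2 : σ (2 : K) = 2 := map_ofNat σ 2
  have ha'e : a' = (a + σ a) / (2 * σ a) := by rw [ha'_def, hu_def]; field_simp
  have hσa' : σ a' = (a + σ a) / (2 * a) := by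
    rw [ha'e, map_div₀, map_add, hσ, map_mul, hσ2, hσ]; ring
  have hσa'0 : σ a' ≠ 0 := by rw [hσa']; exact div_ne_zero htr (mul_ne_zero h2 ha0)
  set ρ : K := a / a' with hρ_def
  have hρ0 : ρ ≠ 0 := div_ne_zero ha0 ha'0
  have hρe : ρ = 2 * a * σ a / (a + σ a) := by rw [hρ_def, ha'e]; field_simp
  have hσρ : σ ρ = ρ := by
    rw [hρe, map_div₀, map_mul, map_mul, hσ2, hσ, map_add, hσ]; ring
  obtain ⟨m', hm'⟩ := exists_val_eq (σ := σ) (θ₀ := θ₀) (c := c) !![a', 0, 0; 0, 1, 0; 0, 0, (σ a')⁻¹]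
    (by rw [det_diag]; exact mul_ne_zero (mul_ne_zero ha'0 one_ne_zero) (inv_ne_zero hσa'0))
    (diag_mem hσ a' 1 ha'0 (by rw [map_one, mul_one]))
  obtain ⟨p, hp⟩ := exists_val_eq (σ := σ) (θ₀ := θ₀) (c := c) !![ρ, 0, 0; 0, 1, 0; 0, 0, ρ⁻¹]
    (by rw [det_diag]; exact mul_ne_zero (mul_ne_zero hρ0 one_ne_zero) (inv_ne_zero hρ0))
    (by simpa only [hσρ] using diag_mem (θ₀ := θ₀) (c := c) hσ ρ 1 hρ0 (by rw [map_one, mul_one]))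
  have hsplit : m.1.1 = (m' * p).1.1 := by
    have h1 : a = a' * ρ := by rw [hρ_def]; field_simp
    have h2' : (σ a)⁻¹ = (σ a')⁻¹ * ρ⁻¹ := by
      rw [h1, map_mul, hσρ, mul_inv]
    rw [val_mul, hm, hm', hp, h2', h1]
    ext i j
    fin_cases i <;> fin_cases j <;> simp [Matrix.mul_apply, Fin.sum_univ_three]
  rw [ext_val hsplit, map_mul, apply_eq_one_of_val_eq_diagFixed hσ hθ hθ0 hc h2 χ p ρ hσρ hρ0 hp, mul_one]
  exact apply_diag_eq_apply_diagMid hσ hθ hθ0 hc hc0 h2 χ u hu hu1 m' z hm' hz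

include hσ hθ hθ0 hc hc0 h2 in
/-- For every `a ≠ 0`: `χ (diag(a, 1, σ(a)⁻¹)) = χ (diag(1, a/σ(a), 1))` (if `a + σ a = 0`, factor
`a = (1 + θ₀) · (a/(1 + θ₀))`, both factors of non-zero trace). [cite: Dieudonne1971GroupesClassiques, Chap. II §5] -/
theorem apply_diag_eq_apply_diagMid'
    (χ : ↥(unitaryGroupOfForm σ !![(0 : K), 0, θ₀; 0, c, 0; -θ₀, 0, 0]) →* A) (a : K) (ha0 : a ≠ 0)
    (m z : ↥(unitaryGroupOfForm σ !![(0 : K), 0, θ₀; 0, c, 0; -θ₀, 0, 0]))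
    (hm : m.1.1 = !![a, 0, 0; 0, 1, 0; 0, 0, (σ a)⁻¹]) (hz : z.1.1 = !![(1 : K), 0, 0; 0, a / σ a, 0; 0, 0, 1]) :
    χ m = χ z := by
  have hσa0 : σ a ≠ 0 := fun h => ha0 (by simpa [hσ] using congrArg σ h)
  by_cases htr : a + σ a ≠ 0
  · exact apply_diag_eq_apply_diagMid_of_trace_ne_zero hσ hθ hθ0 hc hc0 h2 χ a ha0 htr m z hm hz
  rw [not_ne_iff] at htr
  have hσa : σ a = -a := by linear_combination htr
  -- `a₁ = 1 + θ₀`, `a₂ = a / a₁`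
  have hσa₁ : σ (1 + θ₀) = 1 - θ₀ := by rw [map_add, map_one, hθ]; ring
  have ha₁0 : (1 + θ₀ : K) ≠ 0 := by
    intro h
    have h' : σ (1 + θ₀) = 0 := by rw [h, map_zero]
    rw [hσa₁] at h'
    exact h2 (by linear_combination h + h')
  have hσa₁0 : (1 - θ₀ : K) ≠ 0 := by
    intro h
    have h' : σ (1 - θ₀) = 0 := by rw [h, map_zero]
    rw [map_sub, map_one, hθ, sub_neg_eq_add] at h'
    exact ha₁0 h'
  have htr₁ : (1 + θ₀) + σ (1 + θ₀) ≠ 0 := by rw [hσa₁]; ring_nf; exact h2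
  set a₂ : K := a / (1 + θ₀) with ha₂_def
  have ha₂0 : a₂ ≠ 0 := div_ne_zero ha0 ha₁0
  have hσa₂ : σ a₂ = -a / (1 - θ₀) := by rw [ha₂_def, map_div₀, hσa, hσa₁]
  have htr₂ : a₂ + σ a₂ ≠ 0 := by
    rw [hσa₂, ha₂_def]
    rw [div_add_div _ _ ha₁0 hσa₁0]
    refine div_ne_zero ?_ (mul_ne_zero ha₁0 hσa₁0)
    have : a * (1 - θ₀) + (1 + θ₀) * -a = -(2 * θ₀ * a) := by ring
    rw [this]
    exact neg_ne_zero.2 (mul_ne_zero (mul_ne_zero h2 hθ0) ha0)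
  have hσa₂0 : σ a₂ ≠ 0 := fun h => ha₂0 (by simpa [hσ] using congrArg σ h)
  obtain ⟨m₁, hm₁⟩ := exists_val_eq (σ := σ) (θ₀ := θ₀) (c := c)
    !![1 + θ₀, 0, 0; 0, 1, 0; 0, 0, (σ (1 + θ₀))⁻¹]
    (by rw [det_diag, hσa₁]; exact mul_ne_zero (mul_ne_zero ha₁0 one_ne_zero) (inv_ne_zero hσa₁0))
    (diag_mem hσ (1 + θ₀) 1 ha₁0 (by rw [map_one, mul_one]))
  obtain ⟨m₂, hm₂⟩ := exists_val_eq (σ := σ) (θ₀ := θ₀) (c := c) !![a₂, 0, 0; 0, 1, 0; 0, 0, (σ a₂)⁻¹]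
    (by rw [det_diag]; exact mul_ne_zero (mul_ne_zero ha₂0 one_ne_zero) (inv_ne_zero hσa₂0))
    (diag_mem hσ a₂ 1 ha₂0 (by rw [map_one, mul_one]))
  have hN : ∀ b : K, b ≠ 0 → b / σ b * σ (b / σ b) = 1 := by
    intro b hb
    have hσb : σ b ≠ 0 := fun h => hb (by simpa [hσ] using congrArg σ h)
    rw [map_div₀, hσ]; field_simp
  obtain ⟨z₁, hz₁⟩ := exists_val_eq (σ := σ) (θ₀ := θ₀) (c := c)
    !![(1 : K), 0, 0; 0, (1 + θ₀) / σ (1 + θ₀), 0; 0, 0, 1]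
    (by rw [det_diag, hσa₁]; exact mul_ne_zero (mul_ne_zero one_ne_zero (div_ne_zero ha₁0 hσa₁0)) one_ne_zero)
    (diagMid_mem _ (hN (1 + θ₀) ha₁0))
  obtain ⟨z₂, hz₂⟩ := exists_val_eq (σ := σ) (θ₀ := θ₀) (c := c) !![(1 : K), 0, 0; 0, a₂ / σ a₂, 0; 0, 0, 1]
    (by rw [det_diag]; exact mul_ne_zero (mul_ne_zero one_ne_zero (div_ne_zero ha₂0 hσa₂0)) one_ne_zero)
    (diagMid_mem _ (hN a₂ ha₂0))
  have hm12 : m.1.1 = (m₁ * m₂).1.1 := by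
    rw [val_mul, hm, hm₁, hm₂, hσa₂, hσa₁, hσa, ha₂_def]
    ext i j
    fin_cases i <;> fin_cases j <;> simp [Matrix.mul_apply, Fin.sum_univ_three] <;> field_simp
  have hz12 : z.1.1 = (z₁ * z₂).1.1 := by
    rw [val_mul, hz, hz₁, hz₂, hσa₂, hσa₁, hσa, ha₂_def]
    ext i j
    fin_cases i <;> fin_cases j <;> simp [Matrix.mul_apply, Fin.sum_univ_three]
    field_simp
  rw [ext_val hm12, ext_val hz12, map_mul, map_mul,
    apply_diag_eq_apply_diagMid_of_trace_ne_zero hσ hθ hθ0 hc hc0 h2 χ (1 + θ₀) ha₁0 htr₁ m₁ z₁ hm₁ hz₁,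
    apply_diag_eq_apply_diagMid_of_trace_ne_zero hσ hθ hθ0 hc hc0 h2 χ a₂ ha₂0 htr₂ m₂ z₂ hm₂ hz₂]

include hσ hθ hθ0 hc hc0 h2 in
/-- **`χ` kills the determinant-one torus** `diag(a, σ(a)/a, σ(a)⁻¹)`, `a ≠ 0`.
[cite: Dieudonne1971GroupesClassiques, Chap. II §5] -/
theorem apply_eq_one_of_val_eq_diagSU
    (χ : ↥(unitaryGroupOfForm σ !![(0 : K), 0, θ₀; 0, c, 0; -θ₀, 0, 0]) →* A)
    (g : ↥(unitaryGroupOfForm σ !![(0 : K), 0, θ₀; 0, c, 0; -θ₀, 0, 0])) (a : K) (ha0 : a ≠ 0)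
    (hg : g.1.1 = !![a, 0, 0; 0, σ a / a, 0; 0, 0, (σ a)⁻¹]) : χ g = 1 := by
  have hσa0 : σ a ≠ 0 := fun h => ha0 (by simpa [hσ] using congrArg σ h)
  have hNa : a / σ a * σ (a / σ a) = 1 := by rw [map_div₀, hσ]; field_simp
  have hNa' : σ a / a * σ (σ a / a) = 1 := by rw [map_div₀, hσ]; field_simp
  obtain ⟨m, hm⟩ := exists_val_eq (σ := σ) (θ₀ := θ₀) (c := c) !![a, 0, 0; 0, 1, 0; 0, 0, (σ a)⁻¹]
    (by rw [det_diag]; exact mul_ne_zero (mul_ne_zero ha0 one_ne_zero) (inv_ne_zero hσa0))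
    (diag_mem hσ a 1 ha0 (by rw [map_one, mul_one]))
  obtain ⟨z, hz⟩ := exists_val_eq (σ := σ) (θ₀ := θ₀) (c := c) !![(1 : K), 0, 0; 0, a / σ a, 0; 0, 0, 1]
    (by rw [det_diag]; exact mul_ne_zero (mul_ne_zero one_ne_zero (div_ne_zero ha0 hσa0)) one_ne_zero)
    (diagMid_mem _ hNa)
  obtain ⟨z', hz'⟩ := exists_val_eq (σ := σ) (θ₀ := θ₀) (c := c) !![(1 : K), 0, 0; 0, σ a / a, 0; 0, 0, 1]
    (by rw [det_diag]; exact mul_ne_zero (mul_ne_zero one_ne_zero (div_ne_zero hσa0 ha0)) one_ne_zero)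
    (diagMid_mem _ hNa')
  have hg' : g.1.1 = (m * z').1.1 := by
    rw [val_mul, hg, hm, hz']
    ext i j
    fin_cases i <;> fin_cases j <;> simp [Matrix.mul_apply, Fin.sum_univ_three]
  have hzz : (z * z').1.1 = (1 : ↥(unitaryGroupOfForm σ !![(0 : K), 0, θ₀; 0, c, 0; -θ₀, 0, 0])).1.1 := by
    rw [val_mul, hz, hz']
    show _ = (1 : Matrix (Fin 3) (Fin 3) K)
    ext i j
    fin_cases i <;> fin_cases j <;> simp [Matrix.mul_apply, Fin.sum_univ_three, ha0, hσa0]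
  have hzinv : χ z * χ z' = 1 := by rw [← map_mul, ext_val hzz, map_one]
  rw [ext_val hg', map_mul, apply_diag_eq_apply_diagMid' hσ hθ hθ0 hc hc0 h2 χ a ha0 m z hm hz, hzinv]

end Chi

end UnitaryRankThree

end Literature.NumberTheory.Automorphic
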